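import Literature.MathematicalPhysics.QuantumFieldTheory.Balaban1983to89.B9Thm313WholeRDvsWordIntoBHZP

/-!
# `Balaban1983to89.B9Thm313WholeRDvsWordPrintCurrency` — [B9] Thm 3.13 p. 426 + (3.44)∕(3.45) p. 398 + p. 398 (remark after (3.47), «the choice of powers Lʲη is conventional») +
# [4] Lemma 2.1 (2.60) p. 234: THE WORD `R ∘ D\*_U ∘ T` IN PRINT'S CURRENCY — FROM A PRINT-WEIGHTED SOURCE INTO THE PRINT-EXACT TRANSPORTED SITE CLASS `bHZPI (taxiS U) s`
# (programme P-HRGDD, leg (D): the currency wrapper around `B9Thm313WholeRDvsWordIntoBHZP`)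

T. Bałaban, *Propagators for lattice gauge theories in a background field*, Commun. Math. Phys. **99** (1985) 389–434 [`Balaban1985BackgroundPropagators`];
[4] = T. Bałaban, *Propagators and renormalization transformations for lattice gauge theories. II*, Commun. Math. Phys. **96** (1984) 223–250 [`Balaban1984PropagatorsII`].
statement-level skeleton of published theorems with citation tags; proofs where landed; nothing here is a claim about the Yang–Mills mass gap.

WHY THIS FILE (cell `pub-ymgap`, node N06, bundle F7 rows 20–21, seat dag-n06-l g32; HOME `P-HRGDD-LEG-D-MEMO.md` §1 steps 2 + 6 — the UNITS).  The certificate's letter `hrgdd13`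
reads FROM the flat bond input class (`bHXA x ε = bHK (bI x) ε`, print's `|λ| + (Lʲη)^ε‖λ‖_ε` currency) INTO the print-exact transported site class (`bHXT x U ε′ = bHZPIfam (taxiS U) ε′
= Lʲη·bHZP`), while the core `B9Thm313WholeRDvsWordIntoBHZP.hasMaj_R_dvs_comp_into_bHZP` runs in the `(Lʲη)⁻¹`-weighted currency (`bHZKP ∕ bHZP`, sup members in `𝔠^{(−1)}`).  The
two currencies differ by ONE block length, which [4] (2.60) moves between the source and the target block at the cost `L·e^{ε_t d}` above the transfer threshold
(`B9SmoothHolderClassPI.len_le_transfer_geo9K`).  §1 `hasMaj_reweight_cNormR` (IN: a member INTO `𝔠^{(t)}` from `N₀` becomes a member INTO `𝔠^{(t−1)}` from the `(Lʲη)⁻¹`-weighted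
source `weightNorm N₀ (Lʲη)⁻¹`) and `hasMaj_bHZPI_of_weighted_src` (OUT: INTO `bHZP` from the weighted source becomes INTO `bHZPI` from `N₀`); §2 ★★★ `hasMaj_R_dvs_comp_into_bHZPI`:
from the PLAIN direction members of `T` (sup INTO `ofBlocks (blkBK bI)`, `s`-probe INTO `𝔠_P^{(s)}` — exactly leg (A)'s (iii)∕(iv) after the probe pins), the letters `J†_ν`, the split
and (3.49)'s words: `HasMaj N₀ (bHZPI (taxiS U) s) (R ∘ D\*_U ∘ T) (K·e^{−(ρ−ε_t)d})`, and ★★★ `hasMaj_R_dvs_comp_into_bHZPIfam` (the family form at `0 ≤ s ≤ 1`, the certificate's `bHXT`).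
HONEST SCOPE.  Majorant algebra + the cited (2.60) transfer; members, letters and (3.49) words are HYPOTHESES; nothing of [B9]∕[4] asserted; no pin, no certificate edit; COUNT-NEUTRAL;
N06 NOT discharged; nothing continuum ∕ OS ∕ mass gap ∕ Clay.  NEW file; cell `pub-ymgap` (HUMAN RULING D-0062), Track A node N06 [B9], seat `pub-ymgap-dag-n06-l` (g32), 2026-08-30.
-/

namespace Literature.MathematicalPhysics.QuantumFieldTheory.Balaban1983to89.B9Thm313WholeRDvsWordPrintCurrency

open B6Geom246MultiLevelTorus (geomT)
open B6GlobalChartV1 (PV blkV1)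
open B6Ineq2142KLevelV1 (β lvl)
open B6KLevelCensusIndexV1 (KIdx)
open B6Prop22KLevelTorusCensusEta (nKT)
open B9GeoNormsKLevelV1 (geo9K)
open B9Thm34Ext (toB6)
open B9Thm312Whole (GeoOK)
open B9Thm312WholeClasses (cNormR cNormR_loc rwt rwt_nonneg)
open B9RWSums343to347Whole (Facts347)
open B11SectG (BlockNorm HasMaj RowSum)
open B9SectDSup (weightNorm weightNorm_loc)
open B9CoReadingCoords (XBK blkBK)
open B9CoReadingCoordsS (XSK sIK blkSK)
open B9CoReadingCoordsHolder (blkPK probeK wK w₀K)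
open B9CoReadingCoordsHolderAdm (wKA)
open B9GradViaDivLettersTransported (taxiS taxiB)
open B9MultiscaleSmoothPartitionYNear (rNear)
open B9MultiscaleSmoothPartitionYLip (CLip CLip_nonneg)
open B9SmoothHolderClassP (bHZP bHZKP)
open B9SmoothHolderClassPI (bHZPI bHZPI_loc bHZPIfam bHZPIfam_of_mem hasMaj_cNormR_zero_of_ofBlocks len_le_transfer_geo9K)
open B9SmoothHolderClassPProducers (CTel)
open B9Thm313WholeRDvsWordIntoBHZP (hasMaj_R_dvs_comp_into_bHZP)
open Node00 (SiteY FBondY IBondY CfgY toKT)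
open Node00.OpsYSectDCoords (DvcoKH)
open T4RelativeLadder (UnitaryLike)

noncomputable section

variable {d ℓ : ℕ} {hd : 1 ≤ d + 1} {hL : Odd (ℓ + 1) ∧ 1 < ℓ + 1} {b₀ b₁ : ℝ}
variable {𝔸 : Type} [NormedRing 𝔸] [NormedAlgebra ℂ 𝔸] [CompleteSpace 𝔸] [FiniteDimensional ℝ 𝔸]
variable {κ : Type} [Fintype κ]
variable (i : KIdx d ℓ hd hL b₀ b₁) [Fintype (geo9K i).Site] (b : Module.Basis κ ℝ 𝔸)
variable {R₀ : ℝ} {H₀ : Prop}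
variable {F₁ : Type} [AddCommGroup F₁] [Module ℝ F₁]

/-! ## §1 The two (2.60) currency moves -/

omit [CompleteSpace 𝔸] [FiniteDimensional ℝ 𝔸] [Fintype κ] in
/-- ★ **IN**: a member INTO `𝔠^{(t)}_{blk}` from `N₀` at `K·e^{−ρd}` is a member INTO `𝔠^{(t−1)}_{blk}` from the `(Lʲη)⁻¹`-weighted source `weightNorm N₀ (Lʲη)⁻¹` at `L·K·e^{−(ρ−ε_t)d}`
above the (2.60) transfer threshold (one length moves from the target block to the source block). [cite: Balaban1984PropagatorsII, Lemma 2.1 (2.60) p.234 + (2.51) p.232; Balaban1985BackgroundPropagators, p.398 (remark after (3.47))] -/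
theorem hasMaj_reweight_cNormR (hG : GeoOK (geo9K i)) {εt : ℝ} (hεt : 0 < εt) (htr : Real.log (geo9K i).L ≤ εt * (2 * ((ℓ : ℝ) + 1) ^ 2 - 1) * (geo9K i).M)
    {X : Type} [Fintype X] {N₀ : BlockNorm (toB6 (geo9K i) R₀ H₀) F₁} {blk : X → IBondY i} {T : F₁ →ₗ[ℝ] (X → ℝ)} {t K ρ : ℝ} (hK : 0 ≤ K)
    (h : HasMaj N₀ (cNormR R₀ H₀ blk hG.lenle t) T (fun a a' => K * Real.exp (-(ρ * (geo9K i).dist a a')))) :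
    HasMaj (weightNorm N₀ (rwt (geo9K i) (-1)) (rwt_nonneg hG.lenle (-1))) (cNormR R₀ H₀ blk hG.lenle (t - 1)) T
      (fun a a' => (((ℓ + 1 : ℕ) : ℝ)) * K * Real.exp (-((ρ - εt) * (geo9K i).dist a a'))) := by
  intro y' A hA y
  have hΛ : 0 < (geo9K i).len y := hG.lenpos y
  have hΛ' : 0 < (geo9K i).len y' := hG.lenpos y'
  have hN : 0 ≤ N₀.loc y' A := N₀.loc_nonneg _ _
  have h1 := h y' A hA y
  rw [cNormR_loc] at h1
  beta_reduce at h1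
  show _ ≤ (((ℓ + 1 : ℕ) : ℝ)) * K * Real.exp (-((ρ - εt) * (geo9K i).dist y y')) * _
  rw [weightNorm_loc, cNormR_loc, rwt, Real.rpow_neg_one]
  -- `len y' ≤ L e^{ε_t d} len y`, i.e. `(len y)⁻¹ ≤ L e^{ε_t d} (len y')⁻¹`
  have hT := len_le_transfer_geo9K i hεt htr y y'
  have hinv : ((geo9K i).len y)⁻¹ ≤ (((ℓ + 1 : ℕ) : ℝ)) * Real.exp (εt * (geo9K i).dist y y') * ((geo9K i).len y')⁻¹ :=
    calc ((geo9K i).len y)⁻¹ = ((geo9K i).len y')⁻¹ * ((geo9K i).len y' * ((geo9K i).len y)⁻¹) := by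
          rw [← mul_assoc, inv_mul_cancel₀ hΛ'.ne', one_mul]
      _ ≤ ((geo9K i).len y')⁻¹ * ((((ℓ + 1 : ℕ) : ℝ)) * Real.exp (εt * (geo9K i).dist y y') * (geo9K i).len y * ((geo9K i).len y)⁻¹) :=
          mul_le_mul_of_nonneg_left (mul_le_mul_of_nonneg_right hT (inv_nonneg.2 hΛ.le)) (inv_nonneg.2 hΛ'.le)
      _ = (((ℓ + 1 : ℕ) : ℝ)) * Real.exp (εt * (geo9K i).dist y y') * ((geo9K i).len y')⁻¹ := by
          rw [mul_assoc ((((ℓ + 1 : ℕ) : ℝ)) * Real.exp (εt * (geo9K i).dist y y')), mul_inv_cancel₀ hΛ.ne', mul_one, mul_comm]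
  have hsplit : (geo9K i).len y ^ (t - 1) = ((geo9K i).len y)⁻¹ * (geo9K i).len y ^ t := by
    rw [Real.rpow_sub hΛ, Real.rpow_one, div_eq_inv_mul]
  have hE : 0 ≤ K * Real.exp (-(ρ * (geo9K i).dist y y')) * N₀.loc y' A := mul_nonneg (mul_nonneg hK (Real.exp_nonneg _)) hN
  calc (geo9K i).len y ^ (t - 1) * (BlockNorm.ofBlocks (toB6 (geo9K i) R₀ H₀) blk).loc y (T A)
      = ((geo9K i).len y)⁻¹ * ((geo9K i).len y ^ t * (BlockNorm.ofBlocks (toB6 (geo9K i) R₀ H₀) blk).loc y (T A)) := by rw [hsplit, mul_assoc]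
    _ ≤ ((geo9K i).len y)⁻¹ * (K * Real.exp (-(ρ * (geo9K i).dist y y')) * N₀.loc y' A) := mul_le_mul_of_nonneg_left h1 (inv_nonneg.2 hΛ.le)
    _ ≤ ((((ℓ + 1 : ℕ) : ℝ)) * Real.exp (εt * (geo9K i).dist y y') * ((geo9K i).len y')⁻¹) * (K * Real.exp (-(ρ * (geo9K i).dist y y')) * N₀.loc y' A) :=
        mul_le_mul_of_nonneg_right hinv hE
    _ = (((ℓ + 1 : ℕ) : ℝ)) * K * (Real.exp (-(ρ * (geo9K i).dist y y')) * Real.exp (εt * (geo9K i).dist y y')) * (((geo9K i).len y')⁻¹ * N₀.loc y' A) := by ring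
    _ = (((ℓ + 1 : ℕ) : ℝ)) * K * Real.exp (-((ρ - εt) * (geo9K i).dist y y')) * (((geo9K i).len y')⁻¹ * N₀.loc y' A) := by
        rw [← Real.exp_add]; congr 2; ring

omit [CompleteSpace 𝔸] [FiniteDimensional ℝ 𝔸] in
/-- ★ **OUT**: a member INTO `bHZP g s` from the `(Lʲη)⁻¹`-weighted source `weightNorm N₀ (Lʲη)⁻¹` at `K·e^{−ρd}` is a member INTO the print-exact `bHZPI g s = Lʲη·bHZP g s` from `N₀`
at `L·K·e^{−(ρ−ε_t)d}` above the (2.60) transfer threshold (the length moves back). [cite: Balaban1984PropagatorsII, Lemma 2.1 (2.60) p.234 + (2.51) p.232; Balaban1985BackgroundPropagators, (3.40) p.397 + (3.44)–(3.45) p.398] -/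
theorem hasMaj_bHZPI_of_weighted_src (hG : GeoOK (geo9K i)) {εt : ℝ} (hεt : 0 < εt) (htr : Real.log (geo9K i).L ≤ εt * (2 * ((ℓ : ℝ) + 1) ^ 2 - 1) * (geo9K i).M)
    (g : SiteY i → SiteY i → 𝔸ˣ) {s : ℝ} (hs0 : 0 ≤ s) (hs1 : s ≤ 1)
    {N₀ : BlockNorm (toB6 (geo9K i) R₀ H₀) F₁} {T : F₁ →ₗ[ℝ] (XSK κ i → ℝ)} {K ρ : ℝ} (hK : 0 ≤ K)
    (h : HasMaj (weightNorm N₀ (rwt (geo9K i) (-1)) (rwt_nonneg hG.lenle (-1))) (bHZP (κ := κ) i b g (R := R₀) (H := H₀) (s := s) hs0 hs1) T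
      (fun a a' => K * Real.exp (-(ρ * (geo9K i).dist a a')))) :
    HasMaj N₀ (bHZPI (κ := κ) i b g (R := R₀) (H := H₀) (s := s) hs0 hs1) T
      (fun a a' => (((ℓ + 1 : ℕ) : ℝ)) * K * Real.exp (-((ρ - εt) * (geo9K i).dist a a'))) := by
  intro y' A hA y
  have hΛ : 0 < (geo9K i).len y := hG.lenpos y
  have hΛ' : 0 < (geo9K i).len y' := hG.lenpos y'
  have hN : 0 ≤ N₀.loc y' A := N₀.loc_nonneg _ _
  have hP : 0 ≤ (bHZP (κ := κ) i b g (R := R₀) (H := H₀) (s := s) hs0 hs1).loc y (T A) := BlockNorm.loc_nonneg _ _ _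
  have h1 := h y' A hA y
  rw [weightNorm_loc, rwt, Real.rpow_neg_one] at h1
  beta_reduce at h1
  show _ ≤ (((ℓ + 1 : ℕ) : ℝ)) * K * Real.exp (-((ρ - εt) * (geo9K i).dist y y')) * N₀.loc y' A
  rw [bHZPI_loc]
  have hT := len_le_transfer_geo9K i hεt htr y' y
  rw [hG.symm y' y] at hT
  have hE : 0 ≤ K * Real.exp (-(ρ * (geo9K i).dist y y')) := mul_nonneg hK (Real.exp_nonneg _)
  calc (geo9K i).len y * (bHZP (κ := κ) i b g (R := R₀) (H := H₀) (s := s) hs0 hs1).loc y (T A)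
      ≤ (geo9K i).len y * (K * Real.exp (-(ρ * (geo9K i).dist y y')) * (((geo9K i).len y')⁻¹ * N₀.loc y' A)) := mul_le_mul_of_nonneg_left h1 hΛ.le
    _ ≤ ((((ℓ + 1 : ℕ) : ℝ)) * Real.exp (εt * (geo9K i).dist y y') * (geo9K i).len y') * (K * Real.exp (-(ρ * (geo9K i).dist y y')) * (((geo9K i).len y')⁻¹ * N₀.loc y' A)) :=
        mul_le_mul_of_nonneg_right hT (mul_nonneg hE (mul_nonneg (inv_nonneg.2 hΛ'.le) hN))
    _ = (((ℓ + 1 : ℕ) : ℝ)) * K * (Real.exp (-(ρ * (geo9K i).dist y y')) * Real.exp (εt * (geo9K i).dist y y')) * (((geo9K i).len y' * ((geo9K i).len y')⁻¹) * N₀.loc y' A) := by ring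
    _ = (((ℓ + 1 : ℕ) : ℝ)) * K * Real.exp (-((ρ - εt) * (geo9K i).dist y y')) * N₀.loc y' A := by
        rw [← Real.exp_add, mul_inv_cancel₀ hΛ'.ne', one_mul]; congr 2; ring

/-! ## §2 ★★★ The word in print's currency -/

variable (B : B9.Backgrounds) (cfg : B.Cfg → CfgY 𝔸 i) {bI : FBondY i → IBondY i}
variable {dF : ℕ} {δF α L₀ σ c : ℝ}

/-- ★★★ **`R ∘ D\*_U ∘ T` FROM `N₀` INTO THE PRINT-EXACT TRANSPORTED SITE CLASS `bHZPI (taxiS U) s`** from the PLAIN direction members of `T` — per `ν`, the sup member INTO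
`ofBlocks (blkBK bI)` (`h3`, (3.44)-type) and the `s`-probe member INTO `𝔠_P^{(s)}` (`h4`, (3.45)-type with its `(Lʲη)^{−s}` read into the class) —, the letters `J†_ν` (`hJT` class,
`hJT0` sup), the split `hDvs`, (3.49)'s words `hP`∕`hDvP` and `hR : R = ϱ·(I − P)`: `HasMaj N₀ (bHZPI (taxiS U) s) (R ∘ D\*_U ∘ T) (K·e^{−(ρ−ε_t)d})`, `K` closed-form and
member-uniform; rates `0 ≤ ρ ≤ ρ₁ ≤ ρ₃ − ε_t`, `ρ₁ + σ ≤ δ_J`, `ρ + σ + αδ_F ≤ r_P`, final `ρ − ε_t` (two (2.60) moves at `ε_t` each, one absorbed in `δ_V := ρ₃ − ε_t`).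
[cite: Balaban1985BackgroundPropagators, Thm 3.13 (3.153) p.426 + (3.44)–(3.45) p.398 + (3.49) p.399 + p.398 (remark after (3.47)); Balaban1984PropagatorsII, (2.51)–(2.56) pp.232–233 + Lemma 2.1 (2.60)–(2.61) p.234] -/
theorem hasMaj_R_dvs_comp_into_bHZPI {s : ℝ} (hs0 : 0 ≤ s) (hs1 : s ≤ 1)
    (hG : GeoOK (geo9K i)) (hF : Facts347 (geo9K i) R₀ H₀ dF δF α L₀) (hrow : RowSum (toB6 (geo9K i) R₀ H₀) σ c)
    {εt : ℝ} (hεt : 0 < εt) (htr : Real.log (geo9K i).L ≤ εt * (2 * ((ℓ : ℝ) + 1) ^ 2 - 1) * (geo9K i).M)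
    (hβ1 : ∀ f : FBondY i, (geomT i.D).dist (β i.hN i.D i.hk (bI f)) (blkV1 i.hN i.D f) ≤ 1)
    (hlev : ∀ f : FBondY i, lvl i.hN i.D i.hk (bI f) = (blkV1 i.hN i.D f).1.1) (hbI0 : ∀ f : FBondY i, bI f = bI ⟨f.src, 0⟩)
    (hcf : |i.cf| = (nKT (toKT i) : ℝ)) {U : B.Cfg} (hU : ∀ ν x, UnitaryLike (cfg U ν x))
    {PI : Type} [Fintype PI]
    {P R : Module.End ℝ (XSK κ i → ℝ)} {Dvs : (XBK κ i → ℝ) →ₗ[ℝ] (XSK κ i → ℝ)} {Dd : PI → Module.End ℝ (XBK κ i → ℝ)}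
    {JT : PI → (XBK κ i → ℝ) →ₗ[ℝ] (XSK κ i → ℝ)}
    {V : Type} {N₀ : BlockNorm (toB6 (geo9K i) R₀ H₀) (V → ℝ)} {T : (V → ℝ) →ₗ[ℝ] (XBK κ i → ℝ)}
    {CP ϱ r CJ δJ CJ0 C3 C4 ρ₃ ρ₁ ρ : ℝ}
    (hCP : 0 ≤ CP) (hCJ : 0 ≤ CJ) (hCJ0 : 0 ≤ CJ0) (hC3 : 0 ≤ C3) (hC4 : 0 ≤ C4) (hc : 0 ≤ c) (hρ₃ : εt ≤ ρ₃)
    (hρ₁ : 0 ≤ ρ₁) (hρ₁V : ρ₁ ≤ ρ₃ - εt) (hρ₁J : ρ₁ + σ ≤ δJ) (hρ : 0 ≤ ρ) (hρρ₁ : ρ ≤ ρ₁) (hbud : ρ + σ + α * δF ≤ r)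
    (hR : R = ϱ • (LinearMap.id - P)) (hDvs : Dvs = ∑ ν, JT ν ∘ₗ Dd ν)
    (hP : HasMaj (cNormR R₀ H₀ (blkSK i (sIK i bI)) hG.lenle 0) (cNormR R₀ H₀ (blkSK i (sIK i bI)) hG.lenle 0) P
      (fun a a' => CP * Real.exp (-(r * (geo9K i).dist a a'))))
    (hDvP : HasMaj (cNormR R₀ H₀ (blkSK i (sIK i bI)) hG.lenle 0) (cNormR R₀ H₀ (blkBK i bI) hG.lenle 1) (DvcoKH i b B cfg U ∘ₗ P)
      (fun a a' => CP * Real.exp (-(r * (geo9K i).dist a a'))))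
    (hJT : ∀ ν, HasMaj (bHZKP (κ := κ) i b (taxiB i B cfg U) (R := R₀) (H := H₀) (s := s) hs0 hs1)
      (bHZP (κ := κ) i b (taxiS i B cfg U) (R := R₀) (H := H₀) (s := s) hs0 hs1) (JT ν)
      (fun a a' => CJ * Real.exp (-(δJ * (geo9K i).dist a a'))))
    (hJT0 : ∀ ν, HasMaj (cNormR R₀ H₀ (blkBK i bI) hG.lenle (-1)) (cNormR R₀ H₀ (blkSK i (sIK i bI)) hG.lenle (-1)) (JT ν)
      (fun a a' => CJ0 * Real.exp (-(δJ * (geo9K i).dist a a'))))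
    (h3 : ∀ ν, HasMaj N₀ (BlockNorm.ofBlocks (toB6 (geo9K i) R₀ H₀) (blkBK i bI)) (Dd ν ∘ₗ T)
      (fun a a' => C3 * Real.exp (-(ρ₃ * (geo9K i).dist a a'))))
    (h4 : ∀ ν, HasMaj N₀ (cNormR R₀ H₀ (blkPK bI) hG.lenle s) (probeK b (taxiB i B cfg U) (wKA i s) (w₀K i s) ∘ₗ (Dd ν ∘ₗ T))
      (fun a a' => C4 * Real.exp (-(ρ₃ * (geo9K i).dist a a')))) :
    HasMaj N₀ (bHZPI (κ := κ) i b (taxiS i B cfg U) (R := R₀) (H := H₀) (s := s) hs0 hs1) (R ∘ₗ Dvs ∘ₗ T)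
      (fun a a' => (((ℓ + 1 : ℕ) : ℝ)) * ((Fintype.card PI : ℝ) * ((1 + CLip d ℓ) * CJ
          * ((((ℓ + 1 : ℕ) : ℝ) * (|ϱ| * ((((ℓ + 1 : ℕ) : ℝ)) * C3)) + (((ℓ + 1 : ℕ) : ℝ)) ^ (1 - s) * (|ϱ| * ((((ℓ + 1 : ℕ) : ℝ)) * C4)))
            * Real.exp ((ρ₃ - εt) * (rNear d ℓ + 1))) * c)
        + CTel d ℓ b ρ (CP * (geo9K i).L * ((Fintype.card PI : ℝ) * (1 * CJ0 * (|ϱ| * ((((ℓ + 1 : ℕ) : ℝ)) * C3)) * c)) * c)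
          (CP * (geo9K i).L * ((Fintype.card PI : ℝ) * (1 * CJ0 * (|ϱ| * ((((ℓ + 1 : ℕ) : ℝ)) * C3)) * c)) * c))
        * Real.exp (-((ρ - εt) * (geo9K i).dist a a'))) := by
  -- IN: the plain members become `(Lʲη)⁻¹`-currency members from the weighted source
  have hL0 : 0 ≤ (((ℓ + 1 : ℕ) : ℝ)) := Nat.cast_nonneg _
  have hVsup : ∀ ν, HasMaj (weightNorm N₀ (rwt (geo9K i) (-1)) (rwt_nonneg hG.lenle (-1))) (cNormR R₀ H₀ (blkBK i bI) hG.lenle (-1)) (Dd ν ∘ₗ T)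
      (fun a a' => (((ℓ + 1 : ℕ) : ℝ)) * C3 * Real.exp (-((ρ₃ - εt) * (geo9K i).dist a a'))) := fun ν => by
    have h := hasMaj_reweight_cNormR i hG hεt htr (t := 0) hC3 (hasMaj_cNormR_zero_of_ofBlocks hG.lenle (h3 ν))
    rwa [zero_sub] at h
  have hVpr : ∀ ν, HasMaj (weightNorm N₀ (rwt (geo9K i) (-1)) (rwt_nonneg hG.lenle (-1))) (cNormR R₀ H₀ (blkPK bI) hG.lenle (s - 1))
      (probeK b (taxiB i B cfg U) (wKA i s) (w₀K i s) ∘ₗ (Dd ν ∘ₗ T))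
      (fun a a' => (((ℓ + 1 : ℕ) : ℝ)) * C4 * Real.exp (-((ρ₃ - εt) * (geo9K i).dist a a'))) := fun ν =>
    hasMaj_reweight_cNormR i hG hεt htr (t := s) hC4 (h4 ν)
  -- the core in the `(Lʲη)⁻¹` currency
  have hδV : 0 ≤ ρ₃ - εt := sub_nonneg.2 hρ₃
  have hcore := hasMaj_R_dvs_comp_into_bHZP i b B cfg hs0 hs1 hG hF hrow hβ1 hlev hbI0 hcf hU hCP hCJ hCJ0 (mul_nonneg hL0 hC3) (mul_nonneg hL0 hC4) hc hδV
    hρ₁ hρ₁V hρ₁J hρ hρρ₁ hbud hR hDvs hP hDvP hJT hJT0 hVsup hVpr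
  -- OUT: back to print's currency
  have hK : 0 ≤ (Fintype.card PI : ℝ) * ((1 + CLip d ℓ) * CJ
          * ((((ℓ + 1 : ℕ) : ℝ) * (|ϱ| * ((((ℓ + 1 : ℕ) : ℝ)) * C3)) + (((ℓ + 1 : ℕ) : ℝ)) ^ (1 - s) * (|ϱ| * ((((ℓ + 1 : ℕ) : ℝ)) * C4)))
            * Real.exp ((ρ₃ - εt) * (rNear d ℓ + 1))) * c)
        + CTel d ℓ b ρ (CP * (geo9K i).L * ((Fintype.card PI : ℝ) * (1 * CJ0 * (|ϱ| * ((((ℓ + 1 : ℕ) : ℝ)) * C3)) * c)) * c)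
          (CP * (geo9K i).L * ((Fintype.card PI : ℝ) * (1 * CJ0 * (|ϱ| * ((((ℓ + 1 : ℕ) : ℝ)) * C3)) * c)) * c) := by
    have := CLip_nonneg d ℓ
    have hgL : 0 ≤ (geo9K i).L := by rw [show (geo9K i).L = (((ℓ + 1 : ℕ) : ℝ)) from rfl]; positivity
    have hct : 0 ≤ CTel d ℓ b ρ (CP * (geo9K i).L * ((Fintype.card PI : ℝ) * (1 * CJ0 * (|ϱ| * ((((ℓ + 1 : ℕ) : ℝ)) * C3)) * c)) * c)
        (CP * (geo9K i).L * ((Fintype.card PI : ℝ) * (1 * CJ0 * (|ϱ| * ((((ℓ + 1 : ℕ) : ℝ)) * C3)) * c)) * c) :=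
      B9SmoothHolderClassPProducers.CTel_nonneg (d := d) (ℓ := ℓ) (b := b) (δ := ρ) (by positivity) (by positivity)
    positivity
  exact hasMaj_bHZPI_of_weighted_src i b hG hεt htr (taxiS i B cfg U) hs0 hs1 hK hcore

/-- ★★★ **THE FAMILY FORM** (the certificate's `bHXT x U s = bHZPIfam (taxiS U) s` for `0 ≤ s ≤ 1`). [cite: Balaban1985BackgroundPropagators, Thm 3.13 (3.153) p.426 + (3.44)–(3.45) p.398 + (3.49) p.399; Balaban1984PropagatorsII, (2.51)–(2.56) pp.232–233 + Lemma 2.1 (2.60)–(2.61) p.234] -/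
theorem hasMaj_R_dvs_comp_into_bHZPIfam {s : ℝ} (hs0 : 0 ≤ s) (hs1 : s ≤ 1)
    (hG : GeoOK (geo9K i)) (hF : Facts347 (geo9K i) R₀ H₀ dF δF α L₀) (hrow : RowSum (toB6 (geo9K i) R₀ H₀) σ c)
    {εt : ℝ} (hεt : 0 < εt) (htr : Real.log (geo9K i).L ≤ εt * (2 * ((ℓ : ℝ) + 1) ^ 2 - 1) * (geo9K i).M)
    (hβ1 : ∀ f : FBondY i, (geomT i.D).dist (β i.hN i.D i.hk (bI f)) (blkV1 i.hN i.D f) ≤ 1)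
    (hlev : ∀ f : FBondY i, lvl i.hN i.D i.hk (bI f) = (blkV1 i.hN i.D f).1.1) (hbI0 : ∀ f : FBondY i, bI f = bI ⟨f.src, 0⟩)
    (hcf : |i.cf| = (nKT (toKT i) : ℝ)) {U : B.Cfg} (hU : ∀ ν x, UnitaryLike (cfg U ν x))
    {PI : Type} [Fintype PI]
    {P R : Module.End ℝ (XSK κ i → ℝ)} {Dvs : (XBK κ i → ℝ) →ₗ[ℝ] (XSK κ i → ℝ)} {Dd : PI → Module.End ℝ (XBK κ i → ℝ)}
    {JT : PI → (XBK κ i → ℝ) →ₗ[ℝ] (XSK κ i → ℝ)}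
    {V : Type} {N₀ : BlockNorm (toB6 (geo9K i) R₀ H₀) (V → ℝ)} {T : (V → ℝ) →ₗ[ℝ] (XBK κ i → ℝ)}
    {CP ϱ r CJ δJ CJ0 C3 C4 ρ₃ ρ₁ ρ : ℝ}
    (hCP : 0 ≤ CP) (hCJ : 0 ≤ CJ) (hCJ0 : 0 ≤ CJ0) (hC3 : 0 ≤ C3) (hC4 : 0 ≤ C4) (hc : 0 ≤ c) (hρ₃ : εt ≤ ρ₃)
    (hρ₁ : 0 ≤ ρ₁) (hρ₁V : ρ₁ ≤ ρ₃ - εt) (hρ₁J : ρ₁ + σ ≤ δJ) (hρ : 0 ≤ ρ) (hρρ₁ : ρ ≤ ρ₁) (hbud : ρ + σ + α * δF ≤ r)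
    (hR : R = ϱ • (LinearMap.id - P)) (hDvs : Dvs = ∑ ν, JT ν ∘ₗ Dd ν)
    (hP : HasMaj (cNormR R₀ H₀ (blkSK i (sIK i bI)) hG.lenle 0) (cNormR R₀ H₀ (blkSK i (sIK i bI)) hG.lenle 0) P
      (fun a a' => CP * Real.exp (-(r * (geo9K i).dist a a'))))
    (hDvP : HasMaj (cNormR R₀ H₀ (blkSK i (sIK i bI)) hG.lenle 0) (cNormR R₀ H₀ (blkBK i bI) hG.lenle 1) (DvcoKH i b B cfg U ∘ₗ P)
      (fun a a' => CP * Real.exp (-(r * (geo9K i).dist a a'))))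
    (hJT : ∀ ν, HasMaj (bHZKP (κ := κ) i b (taxiB i B cfg U) (R := R₀) (H := H₀) (s := s) hs0 hs1)
      (bHZP (κ := κ) i b (taxiS i B cfg U) (R := R₀) (H := H₀) (s := s) hs0 hs1) (JT ν)
      (fun a a' => CJ * Real.exp (-(δJ * (geo9K i).dist a a'))))
    (hJT0 : ∀ ν, HasMaj (cNormR R₀ H₀ (blkBK i bI) hG.lenle (-1)) (cNormR R₀ H₀ (blkSK i (sIK i bI)) hG.lenle (-1)) (JT ν)
      (fun a a' => CJ0 * Real.exp (-(δJ * (geo9K i).dist a a'))))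
    (h3 : ∀ ν, HasMaj N₀ (BlockNorm.ofBlocks (toB6 (geo9K i) R₀ H₀) (blkBK i bI)) (Dd ν ∘ₗ T)
      (fun a a' => C3 * Real.exp (-(ρ₃ * (geo9K i).dist a a'))))
    (h4 : ∀ ν, HasMaj N₀ (cNormR R₀ H₀ (blkPK bI) hG.lenle s) (probeK b (taxiB i B cfg U) (wKA i s) (w₀K i s) ∘ₗ (Dd ν ∘ₗ T))
      (fun a a' => C4 * Real.exp (-(ρ₃ * (geo9K i).dist a a')))) :
    HasMaj N₀ (bHZPIfam (κ := κ) i b (taxiS i B cfg U) (R := R₀) (H := H₀) s) (R ∘ₗ Dvs ∘ₗ T)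
      (fun a a' => (((ℓ + 1 : ℕ) : ℝ)) * ((Fintype.card PI : ℝ) * ((1 + CLip d ℓ) * CJ
          * ((((ℓ + 1 : ℕ) : ℝ) * (|ϱ| * ((((ℓ + 1 : ℕ) : ℝ)) * C3)) + (((ℓ + 1 : ℕ) : ℝ)) ^ (1 - s) * (|ϱ| * ((((ℓ + 1 : ℕ) : ℝ)) * C4)))
            * Real.exp ((ρ₃ - εt) * (rNear d ℓ + 1))) * c)
        + CTel d ℓ b ρ (CP * (geo9K i).L * ((Fintype.card PI : ℝ) * (1 * CJ0 * (|ϱ| * ((((ℓ + 1 : ℕ) : ℝ)) * C3)) * c)) * c)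
          (CP * (geo9K i).L * ((Fintype.card PI : ℝ) * (1 * CJ0 * (|ϱ| * ((((ℓ + 1 : ℕ) : ℝ)) * C3)) * c)) * c))
        * Real.exp (-((ρ - εt) * (geo9K i).dist a a'))) := by
  rw [bHZPIfam_of_mem i b (taxiS i B cfg U) hs0 hs1]
  exact hasMaj_R_dvs_comp_into_bHZPI i b B cfg hs0 hs1 hG hF hrow hεt htr hβ1 hlev hbI0 hcf hU hCP hCJ hCJ0 hC3 hC4 hc hρ₃ hρ₁ hρ₁V hρ₁J hρ hρρ₁ hbud
    hR hDvs hP hDvP hJT hJT0 h3 h4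

end

end Literature.MathematicalPhysics.QuantumFieldTheory.Balaban1983to89.B9Thm313WholeRDvsWordPrintCurrency
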